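import Literature.NumberTheory.DiophantineGeometry.TateAlgorithm
import Literature.NumberTheory.DiophantineGeometry.TateAlgorithmProofs
import Literature.NumberTheory.DiophantineGeometry.TateAlgorithmLocal
import HarnessLib

/-!
# Tate's algorithm: `ord_v (Δ_min) = m_v + 1` for additive reduction, residue char. `≠ 2, 3`

Discharge of the named fact `WeierstrassCurve.ordMinimalDiscriminant_eq_numComponentsAt_add_one`
of `Literature.NumberTheory.DiophantineGeometry.TateAlgorithm`
(`WeierstrassCurve.ordMinimalDiscriminant_eq_numComponentsAt_add_one_holds`): for an elliptic curve
`W / K` with additive reduction at a finite place `v` of residue characteristic `≠ 2, 3`,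
`ord_v (Δ_min) = m_v + 1`, where `m_v` is the number of irreducible components of the special fibre
read off from the Kodaira symbol computed by Tate's algorithm (Silverman ATAEC IV.9.4 and
Table 4.1, p. 365: `m = 1, 2, 3, 5, 5 + n, 7, 8, 9` and `v(Δ) = 2, 3, 4, 6, 6 + n, 8, 9, 10` for the
additive types `II, III, IV, I₀*, Iₙ*, IV*, III*, II*`, the `v(Δ)` row being valid for
`char k ≠ 2, 3`; step 7: "if `p ≠ 2` then `n = v(Δ) − 6`").

The local analysis over the complete DVR `O_v` is
`Literature.NumberTheory.DiophantineGeometry.TateAlgorithm.addVal_Δ_toNat_eq_numComponents_add_one` (file `TateAlgorithmLocal`); here we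
only supply the bridge from the global statement:

* `WeierstrassCurve.hasAdditiveReductionAt_iff_mem`: Mathlib's `HasAdditiveReduction` (valuations
  on `K_v`) translated to `Δ ∈ 𝔪`, `c₄ ∈ 𝔪` for the integral local minimal model `M`;
* `IsDedekindDomain.HeightOneSpectrum.isUnit_algebraMap_adicCompletionIntegers`: an element of `A`
  outside `v` is a unit of `O_v`; hence `2, 3 ∈ O_vˣ` when `char (A ⧸ v) ≠ 2, 3`;
* minimality of `M` excludes step 11 by `Literature.NumberTheory.DiophantineGeometry.TateAlgorithm.not_isMinimal_of_pow_dvd`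
  (file `TateAlgorithmProofs`).

## References

* J. H. Silverman, *Advanced Topics in the Arithmetic of Elliptic Curves*, GTM 151, 1994, IV.9.4
  and Table 4.1 (p. 365); IV.11.1 (Ogg's formula, of which this is the tame case `f_v = 2`).
-/

open IsDedekindDomain

namespace IsDedekindDomain.HeightOneSpectrum

variable {A : Type*} [CommRing A] [IsDedekindDomain A] (K : Type*) [Field K]
  [Algebra A K] [IsFractionRing A K] (v : HeightOneSpectrum A)

/-- An element of `A` not in the prime `v` is a unit of the completed local ring `O_v`
(its `v`-adic valuation is `1`). [folklore] -/
theorem isUnit_algebraMap_adicCompletionIntegers {a : A} (ha : a ∉ v.asIdeal) :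
    IsUnit (algebraMap A (v.adicCompletionIntegers K) a) := by
  have hv : Valuation.Integers (Valued.v (R := v.adicCompletion K)) (v.adicCompletionIntegers K) :=
    Valuation.valuationSubring.integers _
  rw [hv.isUnit_iff_valuation_eq_one]
  change Valued.v ((algebraMap A (v.adicCompletionIntegers K) a : v.adicCompletion K)) = 1
  rw [algebraMap_adicCompletionIntegers_apply A K v a, valuedAdicCompletion_eq_valuation',
    valuation_of_algebraMap]
  exact intValuation_eq_one_iff.mpr ha

/-- If the residue field `A ⧸ v` has characteristic `≠ 2` then `2 ∈ O_vˣ`. [folklore] -/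
theorem isUnit_two_adicCompletionIntegers (h2 : ringChar (A ⧸ v.asIdeal) ≠ 2) :
    IsUnit (2 : v.adicCompletionIntegers K) := by
  have h : (2 : A) ∉ v.asIdeal := by
    intro hmem
    apply Ring.two_ne_zero h2
    rw [← map_ofNat (Ideal.Quotient.mk v.asIdeal) 2, Ideal.Quotient.eq_zero_iff_mem]
    exact hmem
  simpa only [map_ofNat] using isUnit_algebraMap_adicCompletionIntegers K v h

/-- If the residue field `A ⧸ v` has characteristic `≠ 3` then `3 ∈ O_vˣ`. [folklore] -/
theorem isUnit_three_adicCompletionIntegers (h3 : ringChar (A ⧸ v.asIdeal) ≠ 3) :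
    IsUnit (3 : v.adicCompletionIntegers K) := by
  have h : (3 : A) ∉ v.asIdeal := by
    intro hmem
    apply h3
    apply CharP.ringChar_of_prime_eq_zero Nat.prime_three
    rw [Nat.cast_ofNat, ← map_ofNat (Ideal.Quotient.mk v.asIdeal) 3,
      Ideal.Quotient.eq_zero_iff_mem]
    exact hmem
  simpa only [map_ofNat] using isUnit_algebraMap_adicCompletionIntegers K v h

end IsDedekindDomain.HeightOneSpectrum

namespace WeierstrassCurve

open Literature.NumberTheory.DiophantineGeometry.TateAlgorithm

section Local

variable {A : Type*} [CommRing A] [IsDedekindDomain A] {K : Type*} [Field K]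
  [Algebra A K] [IsFractionRing A K] (v : HeightOneSpectrum A) (W : WeierstrassCurve K)

/-- Additive reduction at `v` in terms of the integral local minimal model `M`:
`π ∣ Δ (M)` and `π ∣ c₄ (M)` (Mathlib's `HasAdditiveReduction`, whose valuation conditions on `K_v`
are translated to ideal membership in `O_v`). Silverman AEC VII.5.1(c). [folklore] -/
theorem hasAdditiveReductionAt_iff_mem :
    W.HasAdditiveReductionAt v ↔
      (W.localMinimalIntegralModel v).Δ ∈
          IsLocalRing.maximalIdeal (v.adicCompletionIntegers K) ∧
        (W.localMinimalIntegralModel v).c₄ ∈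
          IsLocalRing.maximalIdeal (v.adicCompletionIntegers K) := by
  have hmin : (W.localMinimalModel v).IsMinimal (v.adicCompletionIntegers K) := inferInstance
  unfold HasAdditiveReductionAt localMinimalIntegralModel
  rw [hasAdditiveReduction_iff,
    ← integralModel_Δ_eq (v.adicCompletionIntegers K) (W.localMinimalModel v),
    ← integralModel_c₄_eq (v.adicCompletionIntegers K) (W.localMinimalModel v)]
  have h1 : HeightOneSpectrum.valuation (v.adicCompletion K)
      (IsDiscreteValuationRing.maximalIdeal (v.adicCompletionIntegers K))
      (algebraMap (v.adicCompletionIntegers K) (v.adicCompletion K)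
        ((W.localMinimalModel v).integralModel (v.adicCompletionIntegers K)).Δ) < 1 ↔
      ((W.localMinimalModel v).integralModel (v.adicCompletionIntegers K)).Δ ∈
        IsLocalRing.maximalIdeal (v.adicCompletionIntegers K) :=
    HeightOneSpectrum.valuation_lt_one_iff_mem _ _
  have h2 : HeightOneSpectrum.valuation (v.adicCompletion K)
      (IsDiscreteValuationRing.maximalIdeal (v.adicCompletionIntegers K))
      (algebraMap (v.adicCompletionIntegers K) (v.adicCompletion K)
        ((W.localMinimalModel v).integralModel (v.adicCompletionIntegers K)).c₄) < 1 ↔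
      ((W.localMinimalModel v).integralModel (v.adicCompletionIntegers K)).c₄ ∈
        IsLocalRing.maximalIdeal (v.adicCompletionIntegers K) :=
    HeightOneSpectrum.valuation_lt_one_iff_mem _ _
  rw [h1, h2]
  exact ⟨fun h ↦ h.2, fun h ↦ ⟨hmin, h⟩⟩

/-- **Discharge of `WeierstrassCurve.ordMinimalDiscriminant_eq_numComponentsAt_add_one`.**
For an elliptic curve `W / K` with additive reduction at a finite place `v` whose residue field
`A ⧸ v` has characteristic `≠ 2, 3`: `ord_v (Δ_min) = m_v + 1` (equivalently, Ogg's formula with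
tame conductor exponent `f_v = 2`). Proof: Tate's algorithm (Silverman ATAEC IV.9.4) run on the
integral local minimal model over `O_v` (`2, 3 ∈ O_vˣ`), whose steps 3–10 return
`II, III, IV, I₀*, Iₙ*, IV*, III*, II*` exactly when `v(Δ) = 2, 3, 4, 6, 6 + n, 8, 9, 10`
(Table 4.1, p. 365, rows `m` and `v(Δ)`; step 7: "if `p ≠ 2` then `n = v(Δ) − 6`"), step 11 being
excluded by minimality (`Literature.NumberTheory.DiophantineGeometry.TateAlgorithm.addVal_Δ_toNat_eq_numComponents_add_one`,
`Literature.NumberTheory.DiophantineGeometry.TateAlgorithm.not_isMinimal_of_pow_dvd`).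
(Dot-notation extension of the Mathlib namespace `WeierstrassCurve`.)
[cite: SilvermanATAEC1994, IV.9.4 and Table 4.1 (p. 365)] -/
theorem ordMinimalDiscriminant_eq_numComponentsAt_add_one_holds :
    ordMinimalDiscriminant_eq_numComponentsAt_add_one v W := by
  intro hE hadd h2 h3
  have hu2 := HeightOneSpectrum.isUnit_two_adicCompletionIntegers K v h2
  have hu3 := HeightOneSpectrum.isUnit_three_adicCompletionIntegers K v h3
  obtain ⟨hΔ, hc₄⟩ := (hasAdditiveReductionAt_iff_mem v W).mp hadd
  have hΔmin : (W.localMinimalModel v).Δ ≠ 0 := by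
    rw [localMinimalModel, WeierstrassCurve.minimal, variableChange_Δ]
    refine mul_ne_zero (pow_ne_zero _ (Units.ne_zero _)) ?_
    simp only [WeierstrassCurve.baseChange, map_Δ]
    exact (_root_.map_ne_zero (algebraMap K (v.adicCompletion K))).mpr hE.isUnit.ne_zero
  have hΔM : (W.localMinimalIntegralModel v).Δ ≠ 0 := by
    intro h0
    apply hΔmin
    rw [← integralModel_Δ_eq (v.adicCompletionIntegers K) (W.localMinimalModel v)]
    change algebraMap _ _ (W.localMinimalIntegralModel v).Δ = 0
    rw [h0, map_zero]
  have hmin : ((W.localMinimalIntegralModel v).baseChange (v.adicCompletion K)).IsMinimal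
      (v.adicCompletionIntegers K) := by
    rw [localMinimalIntegralModel, baseChange_integralModel_eq]
    infer_instance
  change (IsDiscreteValuationRing.addVal (v.adicCompletionIntegers K)
      (W.localMinimalIntegralModel v).Δ).toNat =
    ((W.localMinimalIntegralModel v).kodairaSymbolOfMinimal).numComponents + 1
  exact addVal_Δ_toNat_eq_numComponents_add_one hu2 hu3 _ hΔM hΔ hc₄
    (fun C _ h₁ h₂ h₃ h₄ h₆ ↦
      not_isMinimal_of_pow_dvd (v.adicCompletion K) hΔM C h₁ h₂ h₃ h₄ h₆ hmin)

end Local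

end WeierstrassCurve
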